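import Summits.NavierStokesRegularity.NavierStokesRegularity.Theses.AxisymmetricExtremality
import Literature.Analysis.FluidPDE.RusinSverakSingularPoint
import Literature.Analysis.FluidPDE.AxisymmetricEuler
import Literature.Analysis.FluidPDE.SelfSimilarLiouville

/-!
# Strategist s8 (independent census, family `-s`) — typed census objects for the crux
`AxisymmetricKatoGlobal` (stmt-NavierStokesRegularity-15453) of route `AxisymmetricExtremality`.

Nothing here is a new route item or a registered line.  The file only TYPES the objects named in
`STRATEGY-CENSUS-s8.md` and kernel-checks the cheap implications between them, so that the census'
"weaker intermediate / decomposition / strengthen" entries are statements, not prose: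

* `NoAxisymMinimalBlowupDatum` (W₀) — the weakest statement that can replace the crux in the
  route's `closes` WITHOUT re-typing the other cruxes (`closes_of_W0`), and `W0_of_crux`.
* `AxisymCriticalNormDip` (W₁) — "an axisymmetric Kato solution that is not global dips strictly
  below its initial `Ḣ^{1/2}` level at some positive time"; `W0_of_dip` (uses the tree lemma
  `hasGlobalKatoSolution_of_lt_rusinSverakRhoMaxPure`), hence `closes_of_dip`.
* the no-rate cut `NoRateSwirlCriterion` (P1) / `SwirlAxisVanishing` (P2) with the proved seam
  `crux_of_noRateCut : P1 → P2 → AxisymmetricKatoGlobal`;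
* the swirl-size cut `SmallSwirlKato` / `LargeSwirlKato` with the proved seam `crux_of_swirlCut`;
* the strengthening S⁺ = the in-tree conjecture `AxisymmetricLiouvilleBoundedSwirl` (referenced).
-/

namespace Summit.NavierStokesRegularity.NavierStokesRegularity.Cruxes.AxisymmetricKatoGlobal.StrategistS8

open Set Function MeasureTheory
open Literature.Analysis.FluidPDE Literature.Analysis.FunctionSpaces
open Summit.NavierStokesRegularity.NavierStokesRegularity.Theses.AxisymmetricExtremality

local notation "ℝ³" => EuclideanSpace ℝ (Fin 3)
local notation "ℂ³" => EuclideanSpace ℂ (Fin 3)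

/-- The symmetry clause of the crux, written out exactly as in the route file
(definitionally `IsAxisymmetric u₀`). -/
def RotInv (u₀ : ℝ³ → ℝ³) : Prop :=
  ∀ (θ : ℝ) (x : ℝ³), u₀ (WithLp.toLp 2 ![Real.cos θ * x 0 - Real.sin θ * x 1,
    Real.sin θ * x 0 + Real.cos θ * x 1, x 2]) = WithLp.toLp 2 ![Real.cos θ * u₀ x 0 -
    Real.sin θ * u₀ x 1, Real.sin θ * u₀ x 0 + Real.cos θ * u₀ x 1, u₀ x 2]

theorem rotInv_iff_isAxisymmetric (u₀ : ℝ³ → ℝ³) : RotInv u₀ ↔ IsAxisymmetric u₀ := Iff.rfl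

/-! ## Weaker intermediates that still feed `closes` -/

/-- **W₀** — no axisymmetric `Ḣ^{1/2}`-minimal blow-up datum (the only instance of the crux that
`closes` consumes). -/
def NoAxisymMinimalBlowupDatum : Prop :=
  ∀ ν : ℝ, 0 < ν → ∀ (u₀ : ℝ³ → ℝ³) (g : HomSobolev ℝ³ ℂ³ (1 / 2 : ℝ)),
    IsMinimalBlowupDatum ν u₀ g → RotInv u₀ → False

/-- crux ⇒ W₀ (W₀ is formally weaker). -/
theorem W0_of_crux (h : AxisymmetricKatoGlobal) : NoAxisymMinimalBlowupDatum := by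
  intro ν hν u₀ g hmin hax
  obtain ⟨hL3, hrep, hdiv, -, hnot⟩ := hmin
  exact hnot (h ν hν u₀ g hL3 hrep hdiv hax)

/-- W₀ replaces the crux in the route's deciding theorem (same pure-logic proof as `closes`). -/
theorem closes_of_W0 (h₂ : MinimalDatumPFold) (h₄ : PFoldToAxisymmetric)
    (h₃ : NoAxisymMinimalBlowupDatum) : NavierStokesRegularity := by
  show Literature.NS.NavierStokesExistenceSmoothR3
  intro ν hν u₀ hsm hdiv hdec
  by_contra hno
  obtain ⟨u₁, g, hmin, hax⟩ := h₄ ν hν (h₂ ν hν ⟨u₀, hsm, hdiv, hdec, hno⟩)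
  exact h₃ ν hν u₁ g hmin hax

/-- **W₁ (critical-norm dip)** — an axisymmetric Kato datum without a global Kato solution has a
local Kato solution one of whose slices `u t₁`, `t₁ > 0`, is again an admissible datum STRICTLY
BELOW the initial `Ḣ^{1/2}` level, and globality propagates back from that slice (semigroup /
uniqueness clause, true for Kato solutions).  Crux ⇒ W₁ vacuously; W₁ ⇒ W₀ below. -/
def AxisymCriticalNormDip : Prop :=
  ∀ ν : ℝ, 0 < ν → ∀ (u₀ : ℝ³ → ℝ³) (g : HomSobolev ℝ³ ℂ³ (1 / 2 : ℝ)),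
    MemLp u₀ 3 volume → g.Represents (Literature.Analysis.FunctionSpaces.EuclideanSpace.complexify ∘ u₀) →
    IsWeaklyDivFree u₀ → RotInv u₀ → ¬ HasGlobalKatoSolution ν u₀ →
    ∃ (T : ℝ) (u : ℝ → ℝ³ → ℝ³) (t₁ : ℝ) (g₁ : HomSobolev ℝ³ ℂ³ (1 / 2 : ℝ)),
      IsKatoSolutionOn T ν u₀ u ∧ t₁ ∈ Ioo 0 T ∧ MemLp (u t₁) 3 volume ∧ IsWeaklyDivFree (u t₁) ∧
      g₁.Represents (Literature.Analysis.FunctionSpaces.EuclideanSpace.complexify ∘ u t₁) ∧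
      ‖g₁‖ₑ < ‖g‖ₑ ∧ (HasGlobalKatoSolution ν (u t₁) → HasGlobalKatoSolution ν u₀)

theorem dip_of_crux (h : AxisymmetricKatoGlobal) : AxisymCriticalNormDip := by
  intro ν hν u₀ g hL3 hrep hdiv hax hnot
  exact absurd (h ν hν u₀ g hL3 hrep hdiv hax) hnot

/-- W₁ ⇒ W₀: at the minimal level `‖g‖ = ρ_max^pure(ν)` a strict dip lands strictly below the
threshold, where every datum is global (`hasGlobalKatoSolution_of_lt_rusinSverakRhoMaxPure`). -/
theorem W0_of_dip (h : AxisymCriticalNormDip) : NoAxisymMinimalBlowupDatum := by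
  intro ν hν u₀ g hmin hax
  obtain ⟨hL3, hrep, hdiv, hnorm, hnot⟩ := hmin
  obtain ⟨T, u, t₁, g₁, -, -, hL3₁, hdiv₁, hrep₁, hlt, hback⟩ := h ν hν u₀ g hL3 hrep hdiv hax hnot
  have hlt' : ‖g₁‖ₑ < rusinSverakRhoMaxPure ν := hnorm ▸ hlt
  exact hnot (hback (hasGlobalKatoSolution_of_lt_rusinSverakRhoMaxPure hL3₁ hrep₁ hdiv₁ hlt'))

theorem closes_of_dip (h₂ : MinimalDatumPFold) (h₄ : PFoldToAxisymmetric)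
    (h₃ : AxisymCriticalNormDip) : NavierStokesRegularity :=
  closes_of_W0 h₂ h₄ (W0_of_dip h₃)

/-! ## Decomposition 1 — the no-rate cut (criterion P1 + a-priori vanishing P2) -/

/-- Uniform-in-time vanishing of the swirl `Γ = swirl (u t)` at the axis on `[t₀, T)`, NO RATE. -/
def AxisVanishingOn (u : ℝ → ℝ³ → ℝ³) (t₀ T : ℝ) : Prop :=
  ∀ ε : ℝ, 0 < ε → ∃ δ : ℝ, 0 < δ ∧ ∀ t ∈ Ico t₀ T, ∀ x : ℝ³, cylRadius x ≤ δ → |swirl (u t) x| ≤ ε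

/-- **P1 (no-rate swirl criterion)** — if along every smooth axisymmetric Kato solution from the
datum the swirl vanishes at the axis uniformly in time (no modulus), the datum is Kato-global.
In print only with a modulus `|ln r|^{-3/2}` (Wei 2016) / `C|ln r|^{-2}` (Lei–Zhang 2017) /
`C/|ln r|³` in the Kato–local-energy setting (tree: `AxisymmetricKatoGlobal_of_logSwirlFacts`). -/
def NoRateSwirlCriterion : Prop :=
  ∀ ν : ℝ, 0 < ν → ∀ (u₀ : ℝ³ → ℝ³) (g : HomSobolev ℝ³ ℂ³ (1 / 2 : ℝ)),
    MemLp u₀ 3 volume → g.Represents (Literature.Analysis.FunctionSpaces.EuclideanSpace.complexify ∘ u₀) →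
    IsWeaklyDivFree u₀ → IsAxisymmetric u₀ →
    (∀ (T : ℝ) (u : ℝ → ℝ³ → ℝ³), 0 < T → IsKatoSolutionOn T ν u₀ u →
      ContDiffOn ℝ (⊤ : ℕ∞) (uncurry u) (Ioo 0 T ×ˢ univ) → (∀ t ∈ Ioo 0 T, IsAxisymmetric (u t)) →
      ∀ t₀ ∈ Ioo 0 T, AxisVanishingOn u t₀ T) →
    HasGlobalKatoSolution ν u₀

/-- **P2 (a-priori no-rate vanishing)** — every smooth axisymmetric Kato solution keeps its swirl
vanishing at the axis uniformly up to the final time (excludes swirl concentration on a collapsing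
scale; no a-priori tool in print short of Type I). -/
def SwirlAxisVanishing : Prop :=
  ∀ ν : ℝ, 0 < ν → ∀ T : ℝ, 0 < T → ∀ (u₀ : ℝ³ → ℝ³) (u : ℝ → ℝ³ → ℝ³),
    IsKatoSolutionOn T ν u₀ u → ContDiffOn ℝ (⊤ : ℕ∞) (uncurry u) (Ioo 0 T ×ˢ univ) →
    (∀ t ∈ Ioo 0 T, IsAxisymmetric (u t)) → ∀ t₀ ∈ Ioo 0 T, AxisVanishingOn u t₀ T

/-- The seam of the no-rate cut (pure logic). -/
theorem crux_of_noRateCut (h1 : NoRateSwirlCriterion) (h2 : SwirlAxisVanishing) :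
    AxisymmetricKatoGlobal := by
  intro ν hν u₀ g hL3 hrep hdiv hax
  have hax' : IsAxisymmetric u₀ := fun θ x => hax θ x
  exact h1 ν hν u₀ g hL3 hrep hdiv hax'
    (fun T u hT hK hsm haxt => h2 ν hν T hT u₀ u hK hsm haxt)

/-! ## Decomposition 2 — the swirl-size cut -/

/-- **Small-swirl piece** — absolute small swirl `|Γ₀| ≤ ε ν` ⇒ Kato-global (the Kato-class form of
route `SwirlThreshold`'s open crux `SmallSwirlRegularity`; print ceiling: product smallness
Lei–Zhang 2017 Thm 1.4 / log-modulus). -/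
def SmallSwirlKato : Prop :=
  ∃ ε : ℝ, 0 < ε ∧ ∀ ν : ℝ, 0 < ν → ∀ (u₀ : ℝ³ → ℝ³) (g : HomSobolev ℝ³ ℂ³ (1 / 2 : ℝ)),
    MemLp u₀ 3 volume → g.Represents (Literature.Analysis.FunctionSpaces.EuclideanSpace.complexify ∘ u₀) →
    IsWeaklyDivFree u₀ → IsAxisymmetric u₀ → (∀ x, |swirl u₀ x| ≤ ε * ν) →
    HasGlobalKatoSolution ν u₀

/-- **Large-swirl piece** — the complement (this piece remains the whole crux in substance: `sup |Γ₀|`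
is scale-invariant and every candidate blow-up scenario has `O(1)` swirl). -/
def LargeSwirlKato (ε : ℝ) : Prop :=
  ∀ ν : ℝ, 0 < ν → ∀ (u₀ : ℝ³ → ℝ³) (g : HomSobolev ℝ³ ℂ³ (1 / 2 : ℝ)),
    MemLp u₀ 3 volume → g.Represents (Literature.Analysis.FunctionSpaces.EuclideanSpace.complexify ∘ u₀) →
    IsWeaklyDivFree u₀ → IsAxisymmetric u₀ → (∃ x, ε * ν < |swirl u₀ x|) →
    HasGlobalKatoSolution ν u₀

/-- The seam of the swirl-size cut (classical case split). -/
theorem crux_of_swirlCut (h1 : SmallSwirlKato) (h2 : ∀ ε : ℝ, 0 < ε → LargeSwirlKato ε) :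
    AxisymmetricKatoGlobal := by
  obtain ⟨ε, hε, hsmall⟩ := h1
  intro ν hν u₀ g hL3 hrep hdiv hax
  have hax' : IsAxisymmetric u₀ := fun θ x => hax θ x
  by_cases hle : ∀ x, |swirl u₀ x| ≤ ε * ν
  · exact hsmall ν hν u₀ g hL3 hrep hdiv hax' hle
  · push_neg at hle
    exact h2 ε hε ν hν u₀ g hL3 hrep hdiv hax' hle

/-! ## Strengthen — the in-tree conjecture used as S⁺ in the census (reference only) -/

example : Prop := Literature.Analysis.FluidPDE.AxisymmetricLiouvilleBoundedSwirl

end Summit.NavierStokesRegularity.NavierStokesRegularity.Cruxes.AxisymmetricKatoGlobal.StrategistS8
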